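import Summits.ResolutionOfSingularities.ResolutionOfSingularities.Theorems.MarkedTransferCampaignW31EdgeHilbertLsc
import Summits.ResolutionOfSingularities.ResolutionOfSingularities.Theorems.MarkedTransferCampaignW31HilbertFunUsc
import Literature.AlgebraicGeometry.Resolution.MaximalContact
import Literature.RingTheory.HilbertSamuel.Quotient
import HarnessLib

/-!
# [OURS · L1 W3.1] `CampaignW31EdgeHilbLsc p` HOLDS — the edge-algebra Hilbert-function semicontinuity lemma
# (slot W3.1 «u.s.c. first», seat res-L1-s31-pv-2; statement typed in `MarkedTransferCampaignW31EdgeHilbertLsc.lean`, p464862)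

Cell `res-hironaka`, rung L. This file PROVES `CampaignW31EdgeHilbLsc_holds : ∀ p, CampaignW31EdgeHilbLsc p` —
input (i) of the OURS argument for the slot statement `CampaignW31UscInvOneExponentI p` (DOSSIER group-3 §1 R13;
the inputs left «outside the kernel» by the tree's `Hironaka2017/EdgeHilbert.lean`): for every perfect field `K`
of characteristic `p`, ambient datum `A`, standard ideal exponent `E` and degree `a`, the function
`ξ ↦ dim_{κ(ξ)} G(ξ)_a = edgeHilbAt E ξ a` (the length of the degree-`a` piece of the edge algebra
`ν(℘(E)_ξ)`, Def. 4.6 p.19) is LOWER semicontinuous on `Sing(E) ∩ Z_cl`.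

In fact more is proved, with NO hypothesis from the manuscript and NO FACT-LIST fact
(`CampaignW31.length_initialPiece_lowerSemicontinuousOn`): for ANY quasi-coherent ideal sheaf `I` on a regular
integral Noetherian scheme `Z` locally of finite type over ANY field, `ξ ↦ ℓ(image of I_ξ ∩ 𝔪_ξ^a in 𝒪_ξ/𝔪_ξ^{a+1})`
is lower semicontinuous along ALL closed points of `Z`; perfectness of `K`, standardness of `E` and the
restriction to `Sing(E)` are not used, and neither is the inclusion `℘(E,a)_ξ ⊆ 𝔪_ξ^a` (lane-A caveat of
2026-08-26T20:13:54Z) — the identity below is stated for the intersection `I_ξ ∩ 𝔪_ξ^a` directly.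

## Proof

* Ring level (`length_map_mkQ_inf_pow_add_hilbertFun_quotient`): for a proper ideal `I` of a Noetherian local
  ring `(𝒪, 𝔪)`, `ℓ(image of I ∩ 𝔪^a in 𝒪/𝔪^{a+1}) + H^{(0)}_{𝒪/I}(a) = H^{(0)}_𝒪(a)` — the degree-`a` piece of the
  initial ideal `in(I) ⊆ gr_𝔪(𝒪)` is the kernel of `gr^a_𝔪(𝒪) → gr^a(𝒪/I)` (tree `gradedPieceMap`,
  `gradedPieceToQuotient`; Mathlib `Module.length_eq_add_of_exact`).
* On `Z`: `H^{(0)}_{𝒪_{Z,ξ}}(a)` is the same number at all closed points (regular local rings of dimension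
  `dim Z`, `hilbertFun_eq_iterPSum_Phi_of_isRegularLocalRing`, `ringKrullDim_stalk_eq_of_isClosed`), and
  `ξ ↦ H^{(0)}_{𝒪_{Z,ξ}/I_ξ}(a) = H^{(0)}_{𝒪_{V(I),ξ}}(a)` is UPPER semicontinuous along the closed points of the closed
  subscheme `V(I)` — Bennett–Singh, closed-point form, `CampaignW31.exists_isOpen_forall_hilbertFun_stalk_le`
  (companion helper `MarkedTransferCampaignW31HilbertFunUsc.lean`, p473940). Off the support of `I` the function is
  locally constant.

HONEST FRAMING. Every declaration is OURS (kernel theorems about Mathlib/tree objects and about the OURS `Prop`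
`CampaignW31EdgeHilbLsc`); NOTHING here is a statement of H. Hironaka's manuscript [Hironaka2017] and nothing of it
is asserted. AI-produced kernel proof; AI review is weaker than expert review.

## References (context)
* V. Cossart, U. Jannsen, S. Saito, LNM 2270 (2020), §2.2, Lemma 2.24, Thm. 2.33. [CossartJannsenSaito2020]
* H. Hironaka, ms. 2017-03-23, Def. 4.6 p.19, p.86 l.7–10 (the unproved use of semicontinuity; GAP-LEDGER R13).
  [Hironaka2017]
-/

noncomputable section

set_option linter.dupNamespace false -- mandated namespace of this single-conjunct summit

open IsLocalRing
open Literature.RingTheory.HilbertSamuel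

namespace Summit.ResolutionOfSingularities.ResolutionOfSingularities.Theorems

namespace CampaignW31

universe u

section Ring

variable {O : Type u} [CommRing O] [IsLocalRing O] [IsNoetherianRing O]

omit [IsNoetherianRing O] in
/-- The image of `𝔪^a` in `O/𝔪^{a+1}` is the range of the embedding `𝔪^a/𝔪^{a+1} ↪ O/𝔪^{a+1}`. [folklore] -/
theorem range_gradedPieceToQuotient (a : ℕ) :
    LinearMap.range (gradedPieceToQuotient O a) =
      Submodule.map (maximalIdeal O ^ (a + 1)).mkQ (maximalIdeal O ^ a) := by
  rw [gradedPieceToQuotient, Submodule.range_liftQ, LinearMap.range_comp, Submodule.range_subtype]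

/-- **`ℓ(image of 𝔪^a in O/𝔪^{a+1}) = H^{(0)}_O(a)`.** [folklore] -/
theorem length_map_mkQ_pow (a : ℕ) :
    Module.length O ↥(Submodule.map (maximalIdeal O ^ (a + 1)).mkQ (maximalIdeal O ^ a)) =
      hilbertFun O a := by
  rw [← range_gradedPieceToQuotient, ← length_gradedPiece_eq_hilbertFun,
    (LinearEquiv.ofInjective _ (gradedPieceToQuotient_injective O a)).length_eq]

omit [IsNoetherianRing O] in
/-- The kernel of `gr^a(O) → gr^a(O/I)` maps, under `gr^a(O) ↪ O/𝔪^{a+1}`, onto the image of `I ∩ 𝔪^a`: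
the degree-`a` initial piece of `I`. [folklore] -/
theorem map_ker_gradedPieceMap_eq (I : Ideal O) (hI : I ≠ ⊤) (a : ℕ) :
    haveI : Nontrivial (O ⧸ I) := Ideal.Quotient.nontrivial_iff.mpr hI
    haveI : IsLocalRing (O ⧸ I) :=
      IsLocalRing.of_surjective' (Ideal.Quotient.mk I) Ideal.Quotient.mk_surjective
    Submodule.map (gradedPieceToQuotient O a)
        (LinearMap.ker (gradedPieceMap (A := O) (B := O ⧸ I) Ideal.Quotient.mk_surjective a)) =
      Submodule.map (maximalIdeal O ^ (a + 1)).mkQ (I ⊓ maximalIdeal O ^ a) := by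
  haveI : Nontrivial (O ⧸ I) := Ideal.Quotient.nontrivial_iff.mpr hI
  haveI : IsLocalRing (O ⧸ I) :=
    IsLocalRing.of_surjective' (Ideal.Quotient.mk I) Ideal.Quotient.mk_surjective
  have hf : Function.Surjective (algebraMap O (O ⧸ I)) := Ideal.Quotient.mk_surjective
  -- membership in the kernel
  have hker : ∀ x : ↥(maximalIdeal O ^ a),
      gradedPiece.mk _ a x ∈ LinearMap.ker (gradedPieceMap (A := O) (B := O ⧸ I) hf a) ↔
        (x : O) ∈ maximalIdeal O ^ (a + 1) ⊔ I := by
    intro x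
    rw [LinearMap.mem_ker, gradedPieceMap_mk, gradedPiece.mk_eq_zero_iff, coe_powMaximalIdealMap_apply,
      ← map_pow_maximalIdeal_eq_of_surjective hf (a + 1), ← Ideal.mem_comap,
      Ideal.comap_map_of_surjective _ hf, Ideal.Quotient.algebraMap_eq]
    have : Ideal.comap (Ideal.Quotient.mk I) ⊥ = I := by
      rw [← RingHom.ker_eq_comap_bot, Ideal.mk_ker]
    rw [this]
  ext q
  constructor
  · rintro ⟨z, hz, rfl⟩
    obtain ⟨x, rfl⟩ := gradedPiece.mk_surjective _ a z
    have hx := (hker x).mp hz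
    obtain ⟨m, hm, i, hi, hmi⟩ := Submodule.mem_sup.mp hx
    refine ⟨i, ⟨hi, ?_⟩, ?_⟩
    · have : i = (x : O) - m := by rw [← hmi]; ring
      rw [this]
      exact (maximalIdeal O ^ a).sub_mem x.2 (Ideal.pow_le_pow_right (Nat.le_succ a) hm)
    · rw [gradedPieceToQuotient_mk, Submodule.mkQ_apply]
      rw [← hmi, Submodule.Quotient.mk_add]
      have : Submodule.Quotient.mk (p := maximalIdeal O ^ (a + 1)) m = 0 :=
        (Submodule.Quotient.mk_eq_zero _).mpr hm
      rw [this, zero_add]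
  · rintro ⟨y, ⟨hyI, hya⟩, rfl⟩
    refine ⟨gradedPiece.mk _ a ⟨y, hya⟩, ?_, rfl⟩
    exact (hker ⟨y, hya⟩).mpr (Submodule.mem_sup_right hyI)

/-- **The initial-piece length identity**: for a proper ideal `I` of a Noetherian local ring `(O, 𝔪)` and
`a : ℕ`, `ℓ(image of I ∩ 𝔪^a in O/𝔪^{a+1}) + H^{(0)}_{O/I}(a) = H^{(0)}_O(a)` — the degree-`a` piece of the
initial ideal of `I` is the kernel of `gr^a_𝔪(O) → gr^a_𝔪(O/I)`. [folklore] -/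
theorem length_map_mkQ_inf_pow_add_hilbertFun_quotient (I : Ideal O) (hI : I ≠ ⊤) (a : ℕ) :
    haveI : Nontrivial (O ⧸ I) := Ideal.Quotient.nontrivial_iff.mpr hI
    haveI : IsLocalRing (O ⧸ I) :=
      IsLocalRing.of_surjective' (Ideal.Quotient.mk I) Ideal.Quotient.mk_surjective
    Module.length O ↥(Submodule.map (maximalIdeal O ^ (a + 1)).mkQ (I ⊓ maximalIdeal O ^ a)) +
        (hilbertFun (O ⧸ I) a : ℕ∞) = hilbertFun O a := by
  haveI : Nontrivial (O ⧸ I) := Ideal.Quotient.nontrivial_iff.mpr hI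
  haveI : IsLocalRing (O ⧸ I) :=
    IsLocalRing.of_surjective' (Ideal.Quotient.mk I) Ideal.Quotient.mk_surjective
  have hf : Function.Surjective (algebraMap O (O ⧸ I)) := Ideal.Quotient.mk_surjective
  have hadd := Module.length_eq_add_of_exact
    (LinearMap.ker (gradedPieceMap (A := O) (B := O ⧸ I) hf a)).subtype
    (gradedPieceMap (A := O) (B := O ⧸ I) hf a) (Submodule.subtype_injective _)
    (gradedPieceMap_surjective hf a) (LinearMap.exact_subtype_ker_map _)
  rw [length_gradedPiece_target_eq_hilbertFun hf, length_gradedPiece_eq_hilbertFun] at hadd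
  rw [hadd, ← map_ker_gradedPieceMap_eq I hI a,
    ← (Submodule.equivMapOfInjective _ (gradedPieceToQuotient_injective O a) _).length_eq]

end Ring

/-! ## An `ℕ∞` bookkeeping lemma -/

/-- If `x + h = m` in `ℕ∞` with `h, m : ℕ` then `x = m - h`. [folklore] -/
theorem enat_eq_natCast_sub {x : ℕ∞} {h m : ℕ} (hx : x + (h : ℕ∞) = (m : ℕ∞)) :
    x = ((m - h : ℕ) : ℕ∞) := by
  induction x using ENat.recTopCoe with
  | top => simp at hx
  | coe k =>
    have hk : k + h = m := by exact_mod_cast hx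
    have : k = m - h := by omega
    subst this
    rfl

/-! ## Lower semicontinuity of the length of the initial piece along the closed points -/

section Scheme

open CategoryTheory TopologicalSpace
open _root_.AlgebraicGeometry _root_.Topology
open Literature.AlgebraicGeometry.Resolution

variable {K : Type u} [Field K] {Z : Scheme.{u}}

/-- **Lower semicontinuity of `ξ ↦ ℓ(image of I_ξ ∩ 𝔪_ξ^a in 𝒪_ξ/𝔪_ξ^{a+1})` along the closed points** of a
regular integral Noetherian scheme `Z` locally of finite type over a field, for ANY quasi-coherent ideal sheaf `I`
and degree `a`: at closed points this length is `H^{(0)}_{𝒪_{Z,ξ}}(a) − H^{(0)}_{𝒪_{Z,ξ}/I_ξ}(a)`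
(`length_map_mkQ_inf_pow_add_hilbertFun_quotient`), the first term is constant (`= binom`, regular local rings of
dimension `dim Z`), and the second is upper semicontinuous along the closed points of the closed subscheme `V(I)`
(`exists_isOpen_forall_hilbertFun_stalk_le`, Bennett–Singh). [folklore] -/
theorem length_initialPiece_lowerSemicontinuousOn (f : Z ⟶ Spec (.of K)) [LocallyOfFiniteType f]
    [IsIntegral Z] [IsNoetherian Z] (hreg : Scheme.IsRegular Z) (I : Z.IdealSheafData) (a : ℕ) :
    LowerSemicontinuousOn
      (fun ξ : Z => Module.length (Z.presheaf.stalk ξ)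
        ↥(Submodule.map (maximalIdeal (Z.presheaf.stalk ξ) ^ (a + 1)).mkQ
          (stalkIdeal I ξ ⊓ maximalIdeal (Z.presheaf.stalk ξ) ^ a)))
      {ξ : Z | IsClosed ({ξ} : Set Z)} := by
  intro ξ₀ hξ₀ y hy
  -- the common dimension `n` of the local rings at closed points and the common value `M = H^{(0)}(a)`
  haveI := hreg ξ₀
  obtain ⟨n, hn⟩ := exists_nat_cast_eq_ringKrullDim (R := Z.presheaf.stalk ξ₀)
  have hH : ∀ ξ : Z, IsClosed ({ξ} : Set Z) → hilbertFun (Z.presheaf.stalk ξ) = iterPSum n Phi := by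
    intro ξ hξ
    haveI := hreg ξ
    refine hilbertFun_eq_iterPSum_Phi_of_isRegularLocalRing _ ?_
    rw [ringKrullDim_stalk_eq_of_isClosed f hξ, ← ringKrullDim_stalk_eq_of_isClosed f hξ₀, hn]
  set M : ℕ := iterPSum n Phi a with hM
  -- notation-free abbreviation of the function
  set F : Z → ℕ∞ := fun ξ : Z => Module.length (Z.presheaf.stalk ξ)
    ↥(Submodule.map (maximalIdeal (Z.presheaf.stalk ξ) ^ (a + 1)).mkQ
      (stalkIdeal I ξ ⊓ maximalIdeal (Z.presheaf.stalk ξ) ^ a)) with hF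
  -- value off the support: `F ξ = M`
  have hoff : ∀ ξ : Z, IsClosed ({ξ} : Set Z) → stalkIdeal I ξ = ⊤ → F ξ = M := by
    intro ξ hξ htop
    simp only [hF]
    rw [htop, top_inf_eq, length_map_mkQ_pow, hH ξ hξ]
  -- value on the support: `F ξ = M - H^{(0)}_{𝒪_ξ/I_ξ}(a)`
  have hon : ∀ ξ : Z, IsClosed ({ξ} : Set Z) → ∀ hne : stalkIdeal I ξ ≠ ⊤,
      haveI : Nontrivial (Z.presheaf.stalk ξ ⧸ stalkIdeal I ξ) := Ideal.Quotient.nontrivial_iff.mpr hne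
      haveI : IsLocalRing (Z.presheaf.stalk ξ ⧸ stalkIdeal I ξ) :=
        IsLocalRing.of_surjective' (Ideal.Quotient.mk _) Ideal.Quotient.mk_surjective
      F ξ = ((M - hilbertFun (Z.presheaf.stalk ξ ⧸ stalkIdeal I ξ) a : ℕ) : ℕ∞) := by
    intro ξ hξ hne
    apply enat_eq_natCast_sub
    have h := length_map_mkQ_inf_pow_add_hilbertFun_quotient (stalkIdeal I ξ) hne a
    rw [hH ξ hξ] at h
    exact h
  have hFle : ∀ ξ : Z, IsClosed ({ξ} : Set Z) → F ξ ≤ M := by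
    intro ξ hξ
    by_cases htop : stalkIdeal I ξ = ⊤
    · exact (hoff ξ hξ htop).le
    · rw [hon ξ hξ htop]
      exact_mod_cast Nat.sub_le _ _
  change y < F ξ₀ at hy
  change ∀ᶠ ξ in 𝓝[{ξ : Z | IsClosed ({ξ} : Set Z)}] ξ₀, y < F ξ
  by_cases h0 : stalkIdeal I ξ₀ = ⊤
  · -- off the support `F` is locally constant `= M`
    have hξ₀s : ξ₀ ∉ I.support := by
      rw [mem_support_iff_stalkIdeal_le, h0, top_le_iff]
      exact (maximalIdeal.isMaximal _).ne_top
    have hW : (I.support : Set Z)ᶜ ∈ 𝓝 ξ₀ := I.support.isClosed.isOpen_compl.mem_nhds hξ₀s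
    filter_upwards [mem_nhdsWithin_of_mem_nhds hW, self_mem_nhdsWithin] with ξ hξW hξC
    have htop : stalkIdeal I ξ = ⊤ := by
      by_contra hne
      exact hξW ((mem_support_iff_stalkIdeal_le I ξ).mpr (IsLocalRing.le_maximalIdeal hne))
    rw [hoff ξ hξC htop]
    exact hy.trans_le (hFle ξ₀ hξ₀)
  · -- on the support: compare Hilbert functions of the closed subscheme `V(I)` at closed points
    have hξ₀s : ξ₀ ∈ I.support :=
      (mem_support_iff_stalkIdeal_le I ξ₀).mpr (IsLocalRing.le_maximalIdeal h0)
    haveI : IsLocallyNoetherian I.subscheme :=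
      LocallyOfFiniteType.isLocallyNoetherian (I.subschemeι ≫ f)
    haveI : CompactSpace I.subscheme := (Scheme.Hom.isClosedEmbedding I.subschemeι).compactSpace
    haveI : IsNoetherian I.subscheme := ⟨⟩
    obtain ⟨c₀, hc₀⟩ : ∃ c : I.subscheme, I.subschemeι c = ξ₀ := by
      rw [← Set.mem_range, Scheme.IdealSheafData.range_subschemeι]; exact hξ₀s
    -- closed points of `V(I)` over closed points of `Z`
    have hcl : ∀ c : I.subscheme, IsClosed ({I.subschemeι c} : Set Z) →
        IsClosed ({c} : Set I.subscheme) := by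
      intro c hc
      have : ({c} : Set I.subscheme) = I.subschemeι ⁻¹' {I.subschemeι c} := by
        ext w
        simp only [Set.mem_singleton_iff, Set.mem_preimage]
        exact ⟨fun h => by rw [h], fun h => (Scheme.Hom.isClosedEmbedding _).injective h⟩
      rw [this]
      exact hc.preimage (Scheme.Hom.continuous _)
    -- Hilbert functions of `V(I)` are those of the quotient stalks
    have htr : ∀ c : I.subscheme, ∀ hne : stalkIdeal I (I.subschemeι c) ≠ ⊤,
        haveI : Nontrivial (Z.presheaf.stalk (I.subschemeι c) ⧸ stalkIdeal I (I.subschemeι c)) :=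
          Ideal.Quotient.nontrivial_iff.mpr hne
        haveI : IsLocalRing (Z.presheaf.stalk (I.subschemeι c) ⧸ stalkIdeal I (I.subschemeι c)) :=
          IsLocalRing.of_surjective' (Ideal.Quotient.mk _) Ideal.Quotient.mk_surjective
        hilbertFun (Z.presheaf.stalk (I.subschemeι c) ⧸ stalkIdeal I (I.subschemeι c)) =
          hilbertFun (I.subscheme.presheaf.stalk c) := by
      intro c hne
      haveI : Nontrivial (Z.presheaf.stalk (I.subschemeι c) ⧸ stalkIdeal I (I.subschemeι c)) :=
        Ideal.Quotient.nontrivial_iff.mpr hne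
      haveI : IsLocalRing (Z.presheaf.stalk (I.subschemeι c) ⧸ stalkIdeal I (I.subschemeι c)) :=
        IsLocalRing.of_surjective' (Ideal.Quotient.mk _) Ideal.Quotient.mk_surjective
      exact hilbertFun_eq_of_ringEquiv (nonempty_stalkSubschemeEquiv I c).some
    subst hc₀
    obtain ⟨W', hc₀W', hW'⟩ :=
      exists_isOpen_forall_hilbertFun_stalk_le (I.subschemeι ≫ f) (hcl c₀ hξ₀)
    obtain ⟨W, hWo, hWW'⟩ :=
      (Scheme.Hom.isClosedEmbedding I.subschemeι).isInducing.isOpen_iff.mp W'.isOpen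
    have hξ₀W : I.subschemeι c₀ ∈ W := by
      have : c₀ ∈ I.subschemeι ⁻¹' W := by rw [hWW']; exact hc₀W'
      exact this
    filter_upwards [mem_nhdsWithin_of_mem_nhds (hWo.mem_nhds hξ₀W), self_mem_nhdsWithin] with ξ hξW hξC
    by_cases htop : stalkIdeal I ξ = ⊤
    · rw [hoff ξ hξC htop]
      exact hy.trans_le (hFle _ hξ₀)
    · have hξs : ξ ∈ I.support := (mem_support_iff_stalkIdeal_le I ξ).mpr (IsLocalRing.le_maximalIdeal htop)
      obtain ⟨c, hc⟩ : ∃ c : I.subscheme, I.subschemeι c = ξ := by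
        rw [← Set.mem_range, Scheme.IdealSheafData.range_subschemeι]; exact hξs
      subst hc
      have hcW' : c ∈ W' := by
        have : c ∈ I.subschemeι ⁻¹' W := hξW
        rw [hWW'] at this
        exact this
      have hle := hW' c hcW' (hcl c hξC) a
      rw [← htr c htop, ← htr c₀ h0] at hle
      rw [hon _ hξ₀ h0] at hy
      rw [hon _ hξC htop]
      refine hy.trans_le ?_
      exact_mod_cast Nat.sub_le_sub_left hle M

end Scheme

/-! ## The campaign statement -/

section Campaign

open CategoryTheory TopologicalSpace
open _root_.AlgebraicGeometry _root_.Topology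
open Literature.AlgebraicGeometry.Resolution
open Literature.AlgebraicGeometry.Hironaka2017
open Literature.AlgebraicGeometry.Hironaka2017.S02Preliminaries
open Literature.AlgebraicGeometry.Hironaka2017.S04CharAlgebra

variable {p : ℕ} [Fact p.Prime] {K : Type u} [Field K] [CharP K p]

/-- **[OURS · L1 W3.1] The edge-algebra Hilbert function `ξ ↦ dim_{κ(ξ)} G(ξ)_a` is lower semicontinuous along
ALL closed points of the ambient scheme** of an ambient datum (`Z` irreducible, smooth, quasi-compact over a field
`K` of characteristic `p` — `K` need NOT be perfect, `E` need NOT be standard): the general lemma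
`length_initialPiece_lowerSemicontinuousOn` for the ideal sheaf `℘(E,a)` (`S04CharAlgebra.pAlg E a`). NOT a
statement of the manuscript. [folklore] -/
theorem edgeHilbAt_lowerSemicontinuousOn_closedPoints (A : AmbientDatum p K) (E : IdealExponent A.Z) (a : ℕ) :
    LowerSemicontinuousOn (fun ξ => edgeHilbAt E ξ a) (S02Preliminaries.closedPoints A.Z) := by
  haveI := A.smooth
  haveI := A.quasiCompact
  haveI := A.irreducible
  haveI : IsLocallyNoetherian A.Z := LocallyOfFiniteType.isLocallyNoetherian A.hom
  haveI : CompactSpace A.Z := QuasiCompact.compactSpace_of_compactSpace A.hom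
  haveI : IsNoetherian A.Z := ⟨⟩
  letI : A.Z.Over (Spec (.of K)) := ⟨A.hom⟩
  haveI : Smooth (A.Z ↘ Spec (.of K)) := A.smooth
  have hreg : Scheme.IsRegular A.Z := Scheme.isRegular_of_smooth_over_field K A.Z
  haveI : ∀ x : A.Z, _root_.IsReduced (A.Z.presheaf.stalk x) := fun x => by
    haveI := hreg x
    haveI := isDomain_of_isRegularLocalRing (A.Z.presheaf.stalk x)
    infer_instance
  haveI : IsReduced A.Z := isReduced_of_isReduced_stalk A.Z
  haveI : IsIntegral A.Z := isIntegral_of_irreducibleSpace_of_isReduced A.Z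
  exact length_initialPiece_lowerSemicontinuousOn A.hom hreg (pAlg E a) a

end Campaign

end CampaignW31

open CampaignW31 in
/-- **[OURS · L1 W3.1] `CampaignW31EdgeHilbLsc p` HOLDS** (the edge-algebra Hilbert-function semicontinuity lemma,
input (i) of the OURS argument for the slot statement of W3.1; typed in
`Theorems/MarkedTransferCampaignW31EdgeHilbertLsc.lean`, p464862): for every perfect field `K` of characteristic
`p`, ambient datum `A`, standard `E` and degree `a`, `ξ ↦ edgeHilbAt E ξ a` is lower semicontinuous on
`Sing(E) ∩ Z_cl`. Kernel proof: restriction to `Sing(E)` of `edgeHilbAt_lowerSemicontinuousOn_closedPoints`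
(perfectness and standardness are not used). Inputs: Bennett–Singh semicontinuity of `H^{(0)}` along closed points
(`CampaignW31.exists_isOpen_forall_hilbertFun_stalk_le`) and the initial-piece length identity
(`CampaignW31.length_map_mkQ_inf_pow_add_hilbertFun_quotient`); NO hypothesis from the manuscript and no FACT-LIST
fact is used. NOT a statement of the manuscript. [folklore] -/
theorem CampaignW31EdgeHilbLsc_holds (p : ℕ) [Fact p.Prime] : CampaignW31EdgeHilbLsc p := by
  intro K _ _ _ A E _ a
  exact (edgeHilbAt_lowerSemicontinuousOn_closedPoints A E a).mono Set.inter_subset_right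

end Summit.ResolutionOfSingularities.ResolutionOfSingularities.Theorems

end
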